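import Literature.AnabelianGeometry.AbsoluteAnabelian.AbsTopIII.KummerPU
import Literature.AnabelianGeometry.AbsoluteAnabelian.AbsTopIII.CuspidalCyclotome
import Literature.AnabelianGeometry.AbsoluteAnabelian.AbsTopIII.KummerIntrinsicSchemaNegative
import HarnessLib

/-!
# [AbsTopIII] Prop. 1.8 (i), (ii) — INSTANCE FORMS of the model-relative schemata
# (FACT-LIST F-0376 / F-0377 / F-0379 / F-0380 / F-0344 / F-0345) and the joint satisfiability of the
# Thm. 1.9 (d)/(e) law bundle

S. Mochizuki, *Topics in Absolute Anabelian Geometry III*, §1, Prop. 1.8 p. 36 (manuscript pagination,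
lit key `paper:url-5493eb38cbb7`; renders `HOME/lit/renders/AbsTopIII-kurims-url-5493eb38cbb7/p0036.txt`):
"(i) A class `η ∈ P_U` is the Kummer class of a nonconstant NF-rational function if and only if there
exist a positive multiple `η†` of `η` and NF-points `x₁, x₂ ∈ U(k_x)` [...] such that [...]
`η†|_{x₁} = 0`, `η†|_{x₂} ≠ 0`"; "(ii) [...] a class `η ∈ P_U ⋂ H¹(G_k, M_X)` is the Kummer class of an
NF-constant `∈ k^×` if and only if there exist a nonconstant NF-rational function `f` [...] and an
NF-point `x` [...] such that `κ_U(f)|_x = η|_{G_{k_x}}`"; printed proof (p. 36 l. 42–50): "any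
nonconstant rational function on `X_NF` determines a morphism `X_NF → ℙ¹` such that the induced map
`X_NF(k̄_NF) → ℙ¹(k̄_NF)` is surjective. In light of this fact [...] assertions (i), (ii) follow
immediately from the definitions."

PROOF-ONLY companion (no `def`, no `instance`, no new named fact) of `KummerIntrinsic.lean` /
`KummerPU.lean` / `CuspidalCyclotome.lean` (abc-iut-L4-t1 lineage; statement files untouched), written
by abc-iut-w5-d047 (gen 6) for the L-F sub-cell [AbsTop*]+[AbsAnab] rows F-0376 F-0377 F-0379 F-0380
F-0344 F-0345 (plan/L4/LF-ABSTOP.tsv, GO abc-iut-L4-lead m38 (h)).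

KERNEL STATUS OF THE SIX ROWS BEFORE THIS FILE (plan/LF-KERNEL-STATUS.tsv 16:01Z): every universal
closure `∀ M, …` is REFUTED (`KummerSchemataClosureRefutations`, `KummerFaithfulPadicConsequences`,
`CuspidalCyclotomeKummerUnitsClosureRefutations`, `KummerPUSchemaNegative`: at junk Kummer data over a
Kummer-faithful field — `ℚ` is one, `isKummerFaithful_rat` — the indeterminate `X ∈ k(X)` is a nonconstant
NF-rational unit with trivial Kummer class and there are no NF-points), with the exact strength
`(∀ M, …) ↔ ∀ k, ¬ IsKummerFaithful k`; INSTANCE forms were in the tree only for F-0376/F-0377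
(`IntrinsicKummerModel.prop_1_8_i_units_of_isEmpty_curve`, `…_ii_…`, `KummerIntrinsicSchemaNegative`).

This file adds the missing instance forms and the JOINT satisfiability statements (all DEGENERATE —
the empty index of curves).  HONEST LABEL (abc-iut-L4-lead ruling 2026-08-26T17:36:39Z): «degenerate
(empty-curve) model instances + JOINT SATISFIABILITY of the Thm. 1.9 (d) law bundle — a CONSISTENCY
certificate for the consumed hypothesis set, not print's instance; genuine = E-L4-15 (the étale-`π₁`
Kummer-model carrier of [AbsTopIII] Def. 1.1–1.6)»:

* `IntrinsicKummerModel.prop_1_8_i_of_isEmpty_curve`, `prop_1_8_ii_of_isEmpty_curve` (F-0379, F-0380)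
  and `prop_1_6_iii_ker_of_isEmpty_curve` (F-0378, kernel form — PROVED at every model modulo F-0340 +
  law (WT) by abc-iut-w6-d075 `KummerPUKerOfWeightLaw`; here only its degenerate instance);
* `IntrinsicKummerModel.exists_model_thm19d_laws` — ONE model carrying SIMULTANEOUSLY the five
  model-laws `Prop_1_8_i`, `Prop_1_8_ii`, `Prop_1_6_iii_units`, `Prop_1_6_iii_ker`, `Prop_1_6_i` that
  [AbsTopIII] Thm. 1.9 (d)/(e) consume BY NAME as the binders `h18i h18ii h16u h16k h16` of
  `thm19d_of_tower` / `thm19e_of_dictionaryTower` / `thm19eSat_of_dictionaryTower` (+ the two units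
  forms F-0376/F-0377): the law bundle of those consumers is not contradictory;
* `KummerCurveModel.exists_isEmpty_curve`, `KummerCurveModel.prop_1_8_i_units_of_isEmpty_curve`,
  `…_ii_…`, `prop_1_6_i_of_isEmpty_curve`, `prop_1_6_iii_units_of_isEmpty_curve`,
  `KummerCurveModel.exists_model_laws` — the same for the EXTRINSIC-cyclotome interface of
  `CuspidalCyclotome.lean` (F-0344, F-0345; F-0342, F-0343).

WHAT IS NOT HERE (honest scope, recorded for the L-F census): a law-level closer "Prop 1.8 at every
model from interface laws" in the PROP16 pattern would need the interface to speak of residue fields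
`k_x` and EVALUATION of regular units at closed points with `s_x^*(κ_U(f)) = κ_{k_x}(f(x))` (the display
"`η†|_{x_i} := s*_{x_i}(η†) ∈ H¹(G_{k_x}, M_X)`" of Prop. 1.8 (i)), `⋂_N (k_x^×)^N = 1` (Kummer-faithful
`k_x`) and the value-surjectivity `X_NF(k̄_NF) ↠ ℙ¹(k̄_NF)` of the printed proof; `CurveModel` /
`DivisorCurveModel` carry `ord_x` but no evaluation map, so any law phrased through `kummerRes (decomp x)`
alone restates (i)/(ii).  The genuine étale-`π₁` carrier (`IntrinsicKummerModel` of a hyperbolic curve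
over a Kummer-faithful field with its geometric Kummer map) is not constructible in the tree today.

HONEST FRAMING: refereed pre-IUT material ([AbsTopIII] §1) outside the [IUTchIII] Cor. 3.12 cone;
typed ≠ proved; instance ≠ the printed theorem; nothing here takes a side on any disputed claim.
-/

namespace Literature.AnabelianGeometry.AbsoluteAnabelian.AbsTopIII

universe u

/-! ### Intrinsic interface (`KummerIntrinsic.lean`, `KummerPU.lean`): F-0379, F-0380, F-0378 -/

namespace IntrinsicKummerModel

/-- F-0379 `Prop_1_8_i` holds at every model with no curves (DEGENERATE instance form).
[cite: MochizukiAbsTopIII2015, Prop 1.8 (i) p.36] -/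
theorem prop_1_8_i_of_isEmpty_curve (M : IntrinsicKummerModel.{u}) [IsEmpty M.Curve] :
    M.Prop_1_8_i :=
  fun U => isEmptyElim U

/-- F-0380 `Prop_1_8_ii` holds at every model with no curves (DEGENERATE instance form).
[cite: MochizukiAbsTopIII2015, Prop 1.8 (ii) p.36] -/
theorem prop_1_8_ii_of_isEmpty_curve (M : IntrinsicKummerModel.{u}) [IsEmpty M.Curve] :
    M.Prop_1_8_ii :=
  fun U => isEmptyElim U

/-- F-0378 `Prop_1_6_iii_ker` holds at every model with no curves (DEGENERATE instance form; the
contentful closer at every model is `prop_1_6_iii_ker_of_prop_1_4_i'_of_weightLaw`).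
[cite: MochizukiAbsTopIII2015, Prop 1.6 (iii) p.35] -/
theorem prop_1_6_iii_ker_of_isEmpty_curve (M : IntrinsicKummerModel.{u}) [IsEmpty M.Curve] :
    M.Prop_1_6_iii_ker :=
  fun U => isEmptyElim U

/-- **Joint satisfiability of the Thm. 1.9 (d)/(e) law bundle**: one model carrying simultaneously
`Prop_1_8_i`, `Prop_1_8_ii`, `Prop_1_6_iii_units`, `Prop_1_6_iii_ker`, `Prop_1_6_i` (the binders
`h18i h18ii h16u h16k h16` of `thm19d_of_tower` / `thm19e_of_dictionaryTower`) together with the units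
forms `Prop_1_8_i_units`, `Prop_1_8_ii_units` (F-0376/F-0377).  DEGENERATE witness (no curves): it
certifies only that the bundle is not contradictory. [cite: MochizukiAbsTopIII2015, Prop 1.8 p.36] -/
theorem exists_model_thm19d_laws :
    ∃ M : IntrinsicKummerModel.{u}, M.Prop_1_8_i ∧ M.Prop_1_8_ii ∧ M.Prop_1_6_iii_units ∧
      M.Prop_1_6_iii_ker ∧ M.Prop_1_6_i ∧ M.Prop_1_8_i_units ∧ M.Prop_1_8_ii_units := by
  obtain ⟨M, hM⟩ := IntrinsicKummerModel.exists_isEmpty_curve.{u}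
  exact ⟨M, prop_1_8_i_of_isEmpty_curve M, prop_1_8_ii_of_isEmpty_curve M,
    prop_1_6_iii_units_of_isEmpty_curve M, prop_1_6_iii_ker_of_isEmpty_curve M,
    prop_1_6_i_of_isEmpty_curve M, prop_1_8_i_units_of_isEmpty_curve M,
    prop_1_8_ii_units_of_isEmpty_curve M⟩

/-- The hypothesis bundle of `thm19d_of_tower` restricted to its five MODEL-LAW binders is met at some
model (consumer-shaped restatement of `exists_model_thm19d_laws`).
[cite: MochizukiAbsTopIII2015, Thm 1.9 (d) p.37] -/
theorem exists_model_thm19d_binders :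
    ∃ M : IntrinsicKummerModel.{u}, M.Prop_1_8_i ∧ M.Prop_1_8_ii ∧ M.Prop_1_6_iii_units ∧
      M.Prop_1_6_iii_ker ∧ M.Prop_1_6_i := by
  obtain ⟨M, h1, h2, h3, h4, h5, -, -⟩ := exists_model_thm19d_laws.{u}
  exact ⟨M, h1, h2, h3, h4, h5⟩

end IntrinsicKummerModel

/-! ### Extrinsic interface (`CuspidalCyclotome.lean`): F-0344, F-0345 (and F-0342, F-0343) -/

namespace KummerCurveModel

/-- **`KummerCurveModel` has an inhabitant with an EMPTY index of curves** (DEGENERATE: the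
`CurveModel` part of `IntrinsicKummerModel.exists_isEmpty_curve`, Kummer data eliminated).
[cite: MochizukiAbsTopIII2015, Prop 1.6 p.34] -/
theorem exists_isEmpty_curve : ∃ M : KummerCurveModel.{u}, IsEmpty M.Curve := by
  obtain ⟨I, hI⟩ := IntrinsicKummerModel.exists_isEmpty_curve.{u}
  exact ⟨{ toCurveModel := I.toCurveModel
           regularUnits := fun U => isEmptyElim U
           kummer := fun {U} => isEmptyElim U }, hI⟩

/-- F-0344 `Prop_1_8_i_units` (extrinsic form) holds at every model with no curves (DEGENERATE
instance form). [cite: MochizukiAbsTopIII2015, Prop 1.8 (i) p.36] -/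
theorem prop_1_8_i_units_of_isEmpty_curve (M : KummerCurveModel.{u}) [IsEmpty M.Curve] :
    Prop_1_8_i_units M :=
  fun U => isEmptyElim U

/-- F-0345 `Prop_1_8_ii_units` (extrinsic form) holds at every model with no curves (DEGENERATE
instance form). [cite: MochizukiAbsTopIII2015, Prop 1.8 (ii) p.36] -/
theorem prop_1_8_ii_units_of_isEmpty_curve (M : KummerCurveModel.{u}) [IsEmpty M.Curve] :
    Prop_1_8_ii_units M :=
  fun U => isEmptyElim U

/-- F-0342 `Prop_1_6_i` (extrinsic form) holds at every model with no curves (DEGENERATE instance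
form; the contentful closer is abc-iut-w6-d075's `KummerCurveModel.prop_1_6_i_of_kummerExact`).
[cite: MochizukiAbsTopIII2015, Prop 1.6 (i) p.34] -/
theorem prop_1_6_i_of_isEmpty_curve (M : KummerCurveModel.{u}) [IsEmpty M.Curve] :
    Prop_1_6_i M :=
  fun U => isEmptyElim U

/-- F-0343 `Prop_1_6_iii_units` (extrinsic form) holds at every model with no curves (DEGENERATE
instance form). [cite: MochizukiAbsTopIII2015, Prop 1.6 (iii) p.35] -/
theorem prop_1_6_iii_units_of_isEmpty_curve (M : KummerCurveModel.{u}) [IsEmpty M.Curve] :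
    Prop_1_6_iii_units M :=
  fun U => isEmptyElim U

/-- **Joint satisfiability of the extrinsic law bundle** `Prop_1_6_i ∧ Prop_1_6_iii_units ∧
Prop_1_8_i_units ∧ Prop_1_8_ii_units` (F-0342/F-0343/F-0344/F-0345) at one `KummerCurveModel`
(DEGENERATE witness). [cite: MochizukiAbsTopIII2015, Prop 1.8 p.36] -/
theorem exists_model_laws :
    ∃ M : KummerCurveModel.{u}, Prop_1_6_i M ∧ Prop_1_6_iii_units M ∧ Prop_1_8_i_units M ∧
      Prop_1_8_ii_units M := by
  obtain ⟨M, hM⟩ := exists_isEmpty_curve.{u}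
  exact ⟨M, prop_1_6_i_of_isEmpty_curve M, prop_1_6_iii_units_of_isEmpty_curve M,
    prop_1_8_i_units_of_isEmpty_curve M, prop_1_8_ii_units_of_isEmpty_curve M⟩

end KummerCurveModel

end Literature.AnabelianGeometry.AbsoluteAnabelian.AbsTopIII
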